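import Summits.ResolutionOfSingularities.ResolutionOfSingularities.Theorems.RadicialJungCleanModelsF75cTripleLoop
import Literature.AlgebraicGeometry.Resolution.CurveConfigurationSnc
import Literature.AlgebraicGeometry.Resolution.RegularCentreRsopPart
import Literature.AlgebraicGeometry.Resolution.Lemma411DivisorPoints
import HarnessLib

/-!
# [F-75c discharge, brick L3] A GOOD configuration with no triple point (plus isolated points with one-dimensional
# regular local rings) is a strict normal crossings divisor (The Stacks Project, Lemma 54.15.6 = Tag 0BIC, proof ¶2,
# last sentence: «This means that `Σ Y_i` is a strict normal crossings divisor … see Étale Morphisms, Lemma 41.21.2»)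

Cell res-hironaka, D-0154 INPUTS discharger `res-inputs-p-f75c` for the named fact F-75c
`Literature.AlgebraicGeometry.Resolution.Stacks0BIC_embeddedResolutionCurvesInSurfaces_locus`
(`--supports stmt-ResolutionOfSingularities-15917 --as helper`). Glue between the loops (bricks L1, L2: members
`cl{η}` regular and pairwise transversal, no point on three members) and brick (v) FINAL
(`isStrictNormalCrossingsDivisor_biUnion_of_curveConfiguration`, hypotheses in `IsRsopPart` currency):

* `exists_isRsopPart_one_of_member` — at a point `p` of a regular member `C`, `𝓘_{C,p} = (f)` with `f` part of a regular
  system of parameters (Matsumura 14.2 with the dimension count `dim 𝒪_{C,p} + 1 = dim 𝒪_{Y,p}`: at the generic point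
  `0 + 1 = 1`, at a closed point `1 + 1 = 2`);
* `isRsopPart_pair_of_sup_eq` — at a common point of two transversal members the two generators form a regular system of
  parameters (`(f) + (g) = 𝔪_p`, `dim 𝒪_{Y,p} = 2`);
* **`isStrictNormalCrossingsDivisor_of_good`** — GOOD + no triple point, together with a finite set `P` of closed points
  with one-dimensional (regular) local rings off the members: `⋃ 𝒞 ∪ P` is a strict normal crossings divisor.

HONEST FRAMING: bookkeeping over tree theorems; nothing here is a statement of [Hironaka2017]. AI-written; AI review is
weaker than expert review. References: The Stacks Project, Tags 0BIC, 0BIA [StacksProject]; Matsumura, Thm. 14.2 [Matsumura1987].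
-/

noncomputable section

set_option linter.dupNamespace false -- mandated namespace of this single-conjunct summit

open CategoryTheory AlgebraicGeometry TopologicalSpace IsLocalRing

namespace Summit.ResolutionOfSingularities.ResolutionOfSingularities.Theorems

namespace F75c

open Literature.AlgebraicGeometry.Resolution
open Literature.AlgebraicGeometry.Resolution.CurveConfiguration
open Summit.ResolutionOfSingularities.ResolutionOfSingularities.Theorems.CP2008Prop44
open Scheme.IdealSheafData

universe u

variable {Y : Scheme.{u}} [IsNoetherian Y]

omit [AlgebraicGeometry.IsNoetherian Y] in
/-- The image of the generic point of the reduced subscheme of a member `C = cl{η}` is `η`. [folklore] -/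
private theorem subschemeι_genericPoint_eq {C : Closeds Y} {η : Y} (hCη : (C : Set Y) = closure {η})
    [IsIntegral (vanishingIdeal C).subscheme] :
    (vanishingIdeal C).subschemeι (genericPoint (vanishingIdeal C).subscheme) = η := by
  have h1 : (C : Set Y) ⊆ closure {(vanishingIdeal C).subschemeι (genericPoint (vanishingIdeal C).subscheme)} :=
    subset_of_subschemeι_genericPoint_mem C ⟨closure {(vanishingIdeal C).subschemeι
      (genericPoint (vanishingIdeal C).subscheme)}, isClosed_closure⟩ (subset_closure (Set.mem_singleton _))
  have h2 : closure {(vanishingIdeal C).subschemeι (genericPoint (vanishingIdeal C).subscheme)} ⊆ (C : Set Y) :=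
    closure_minimal (Set.singleton_subset_iff.mpr (subschemeι_mem C _)) C.isClosed
  have hgen : IsGenericPoint ((vanishingIdeal C).subschemeι (genericPoint (vanishingIdeal C).subscheme)) (C : Set Y) :=
    isGenericPoint_def.mpr (le_antisymm h2 h1)
  have hgen' : IsGenericPoint η (C : Set Y) := isGenericPoint_def.mpr hCη.symm
  exact hgen.eq hgen'

/-- **At a point of a regular member its germ is generated by one member of a regular system of parameters.**
[cite: Matsumura1987, Thm. 14.2] [cite: StacksProject, Tag 0BIC (Lemma 54.15.6, proof ¶2)] -/
theorem exists_isRsopPart_one_of_member (hregY : Scheme.IsRegular Y) (hqe : Scheme.IsQuasiExcellent Y)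
    (hY2 : topologicalKrullDim Y ≤ 2) {C : Closeds Y} {η : Y} (hCη : (C : Set Y) = closure {η})
    (hηcl : ¬ IsClosed ({η} : Set Y)) (hη1 : ringKrullDim (Y.presheaf.stalk η) = 1)
    (hregC : Scheme.IsRegular (vanishingIdeal C).subscheme) {p : Y} (hp : p ∈ (C : Set Y)) :
    ∃ f : Y.presheaf.stalk p, IsRsopPart ![f] ∧ stalkIdeal (vanishingIdeal C) p = Ideal.span {f} := by
  haveI := hregY p
  have hCeq : C = ⟨closure {η}, isClosed_closure⟩ := Closeds.ext hCη
  obtain ⟨hint, hnoeth, -, hdim1⟩ := member_props hqe hY2 hη1 hηcl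
  rw [← hCeq] at hint hnoeth hdim1
  haveI := hint; haveI := hnoeth
  obtain ⟨c, hc⟩ := exists_subschemeι_eq C hp
  -- the dimension count `dim 𝒪_{C,c} + 1 = dim 𝒪_{Y,p}`
  have hdimq : ringKrullDim (Y.presheaf.stalk p ⧸ stalkIdeal (vanishingIdeal C) p) + 1 =
      ringKrullDim (Y.presheaf.stalk p) := by
    have hrd : ringKrullDim ((vanishingIdeal C).subscheme.presheaf.stalk c) =
        ringKrullDim (Y.presheaf.stalk p ⧸ stalkIdeal (vanishingIdeal C) p) :=
      DeJong1996.ringKrullDim_stalk_reduced_eq (Z := (C : Set Y)) C.isClosed c hc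
    rw [← hrd]
    by_cases hcg : c = genericPoint (vanishingIdeal C).subscheme
    · -- at the generic point: `0 + 1 = 1`
      have hpη : p = η := by rw [← hc, hcg]; exact subschemeι_genericPoint_eq hCη
      subst hcg
      rw [hpη, hη1, ringKrullDim_eq_zero_of_isField (Field.toIsField _)]
      rfl
    · -- at a closed point: `1 + 1 = 2`
      have hpcl : IsClosed ({p} : Set Y) := hc ▸ isClosed_singleton_subschemeι_of_ne C hdim1 hcg
      have hp2 : ringKrullDim (Y.presheaf.stalk p) = 2 :=
        ringKrullDim_stalk_eq_two_of_mem_closure hY2 hη1 hpcl hηcl (hCη ▸ hp)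
      rcases isField_or_ringKrullDim_eq_one hdim1.le c with hF | h1
      · exact absurd hF (not_isField_stalk_of_subschemeι_eq C hdim1 hpcl hc)
      · rw [h1, hp2]; rfl
  obtain ⟨z, hz, hzspan⟩ := exists_isRsopPart_fin_span_range_eq_stalkIdeal_of_mem_closeds hregC hp (r := 1) hdimq
  refine ⟨z 0, ?_, ?_⟩
  · have : ![z 0] = z := by funext i; fin_cases i; rfl
    rw [this]; exact hz
  · rw [← hzspan]
    congr 1
    ext a
    simp only [Set.mem_range, Set.mem_singleton_iff]
    constructor
    · rintro ⟨i, rfl⟩; fin_cases i; rfl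
    · rintro rfl; exact ⟨0, rfl⟩

/-- **At a common point of two transversal members of a surface the two generators form a regular system of
parameters** (`(f) + (g) = 𝔪_p`, `dim 𝒪_{Y,p} = 2`). [cite: Matsumura1987, Thm. 14.2]
[cite: StacksProject, Tag 0BIC (Lemma 54.15.6, proof ¶2)] -/
theorem isRsopPart_pair_of_sup_eq {R : Type u} [CommRing R] [IsRegularLocalRing R] (h2 : ringKrullDim R = 2)
    {f g : R} (hfg : Ideal.span {f} ⊔ Ideal.span {g} = maximalIdeal R) : IsRsopPart ![f, g] := by
  have hspan : Ideal.span (Set.range ![f, g]) = maximalIdeal R := by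
    rw [← hfg, ← Ideal.span_union, Set.singleton_union]
    congr 1
    ext a
    simp only [Set.mem_range, Set.mem_insert_iff, Set.mem_singleton_iff]
    constructor
    · rintro ⟨i, rfl⟩; fin_cases i <;> simp
    · rintro (rfl | rfl)
      · exact ⟨0, rfl⟩
      · exact ⟨1, rfl⟩
  have hzm : ∀ i, ![f, g] i ∈ maximalIdeal R := fun i => hspan ▸ Ideal.subset_span ⟨i, rfl⟩
  letI : Field (R ⧸ maximalIdeal R) := Ideal.Quotient.field _
  haveI : IsRegularLocalRing (R ⧸ Ideal.span (Set.range ![f, g])) := by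
    rw [hspan]; infer_instance
  refine IsRsopPart.of_isRegularLocalRing_quotient hzm ?_
  rw [hspan, h2, ringKrullDim_eq_zero_of_isField (Field.toIsField _)]
  exact le_of_eq (by rfl)

/-- **GOOD with no triple point ⇒ strict normal crossings** (Stacks 0BIC ¶2, last sentence, via 0BIA): on a Noetherian
regular quasi-excellent scheme of dimension `≤ 2`, the union of a finite GOOD configuration of members with no triple
point and of a finite set `P` of closed points with one-dimensional local rings lying on no member is a strict normal
crossings divisor. [cite: StacksProject, Tag 0BIC (Lemma 54.15.6, proof ¶2)] [cite: StacksProject, Tag 0BIA (Lemma 41.21.2)] -/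
theorem isStrictNormalCrossingsDivisor_of_good (hregY : Scheme.IsRegular Y) (hqe : Scheme.IsQuasiExcellent Y)
    (hY2 : topologicalKrullDim Y ≤ 2) {𝒞 : Set (Closeds Y)} (hfin : 𝒞.Finite)
    (hmem : ∀ C ∈ 𝒞, ∃ η : Y, (C : Set Y) = closure {η} ∧ ¬ IsClosed ({η} : Set Y) ∧
      ringKrullDim (Y.presheaf.stalk η) = 1)
    (hregC : ∀ C ∈ 𝒞, Scheme.IsRegular (vanishingIdeal C).subscheme)
    (htr : ∀ C ∈ 𝒞, ∀ C' ∈ 𝒞, C ≠ C' → ∀ q ∈ (C : Set Y) ∩ (C' : Set Y),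
      stalkIdeal (vanishingIdeal C) q ⊔ stalkIdeal (vanishingIdeal C') q = maximalIdeal (Y.presheaf.stalk q))
    (hnt : ∀ q : Y, ¬ ∃ C₁ ∈ 𝒞, ∃ C₂ ∈ 𝒞, ∃ C₃ ∈ 𝒞, C₁ ≠ C₂ ∧ C₁ ≠ C₃ ∧ C₂ ≠ C₃ ∧
      q ∈ (C₁ : Set Y) ∧ q ∈ (C₂ : Set Y) ∧ q ∈ (C₃ : Set Y))
    {P : Set Y} (hPfin : P.Finite) (hPcl : ∀ p ∈ P, IsClosed ({p} : Set Y))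
    (hP1 : ∀ p ∈ P, ringKrullDim (Y.presheaf.stalk p) = 1) (hPoff : ∀ p ∈ P, ∀ C ∈ 𝒞, p ∉ (C : Set Y)) :
    IsStrictNormalCrossingsDivisor Y ((⋃ C ∈ 𝒞, (C : Set Y)) ∪ P) := by
  classical
  -- the family: the members and the singletons of `P`
  set 𝒟 : Set (Closeds Y) := 𝒞 ∪ (fun p : Y => (⟨closure {p}, isClosed_closure⟩ : Closeds Y)) '' P with h𝒟
  have hsing : ∀ p ∈ P, ((⟨closure {p}, isClosed_closure⟩ : Closeds Y) : Set Y) = {p} := fun p hp =>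
    (hPcl p hp).closure_eq
  have hU : (⋃ D ∈ 𝒟, (D : Set Y)) = (⋃ C ∈ 𝒞, (C : Set Y)) ∪ P := by
    rw [h𝒟, Set.biUnion_union, Set.biUnion_image]
    congr 1
    ext y
    simp only [Set.mem_iUnion, exists_prop]
    constructor
    · rintro ⟨p, hp, hy⟩
      rw [hsing p hp, Set.mem_singleton_iff] at hy
      exact hy ▸ hp
    · intro hy
      exact ⟨y, hy, by rw [hsing y hy]; exact Set.mem_singleton y⟩
  rw [← hU]
  -- generators at points of members
  have hb𝒞 : ∀ C ∈ 𝒞, ∀ p ∈ (C : Set Y), ∃ f : Y.presheaf.stalk p,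
      IsRsopPart ![f] ∧ stalkIdeal (vanishingIdeal C) p = Ideal.span {f} := by
    intro C hC p hp
    obtain ⟨η, hCη, hηcl, hη1⟩ := hmem C hC
    exact exists_isRsopPart_one_of_member hregY hqe hY2 hCη hηcl hη1 (hregC C hC) hp
  -- generators at the isolated points
  have hbP : ∀ p ∈ P, ∃ f : Y.presheaf.stalk p, IsRsopPart ![f] ∧
      stalkIdeal (vanishingIdeal (⟨closure {p}, isClosed_closure⟩ : Closeds Y)) p = Ideal.span {f} := by
    intro p hp
    haveI := hregY p
    letI : Field (Y.presheaf.stalk p ⧸ maximalIdeal (Y.presheaf.stalk p)) := Ideal.Quotient.field _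
    have hdimq : ringKrullDim (Y.presheaf.stalk p ⧸ maximalIdeal (Y.presheaf.stalk p)) + 1 =
        ringKrullDim (Y.presheaf.stalk p) := by
      rw [hP1 p hp, ringKrullDim_eq_zero_of_isField (Field.toIsField _)]; rfl
    obtain ⟨z, hz, hzspan⟩ := exists_isRsopPart_fin_span_range_eq (R := Y.presheaf.stalk p) le_rfl (r := 1) hdimq
    refine ⟨z 0, ?_, ?_⟩
    · have : ![z 0] = z := by funext i; fin_cases i; rfl
      rw [this]; exact hz
    · rw [stalkIdeal_vanishingIdeal_closure_self, ← hzspan]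
      congr 1
      ext a
      simp only [Set.mem_range, Set.mem_singleton_iff]
      constructor
      · rintro ⟨i, rfl⟩; fin_cases i; rfl
      · rintro rfl; exact ⟨0, rfl⟩
  -- a singleton member meets nothing else
  have hPmem : ∀ p ∈ P, ∀ {q : Y}, q ∈ (((⟨closure {p}, isClosed_closure⟩ : Closeds Y)) : Set Y) → q = p := by
    intro p hp q hq
    rw [hsing p hp, Set.mem_singleton_iff] at hq
    exact hq
  refine isStrictNormalCrossingsDivisor_biUnion_of_curveConfiguration hregY
    (hfin.union (hPfin.image _)) ?_ ?_ ?_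
  · -- (b)
    rintro D (hD | ⟨p, hp, rfl⟩) q hq
    · exact hb𝒞 D hD q hq
    · obtain rfl := hPmem p hp hq
      exact hbP q hp
  · -- (c)
    rintro D (hD | ⟨p, hp, rfl⟩) D' (hD' | ⟨p', hp', rfl⟩) hne q ⟨hq, hq'⟩
    · obtain ⟨f, hf, hfspan⟩ := hb𝒞 D hD q hq
      obtain ⟨g, hg, hgspan⟩ := hb𝒞 D' hD' q hq'
      haveI := hregY q
      obtain ⟨η, hDη, hηcl, hη1⟩ := hmem D hD
      have hqcl : IsClosed ({q} : Set Y) := isClosed_of_mem_inter hqe hY2 hmem hD hD' hne hq hq'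
      have hq2 : ringKrullDim (Y.presheaf.stalk q) = 2 :=
        ringKrullDim_stalk_eq_two_of_mem_closure hY2 hη1 hqcl hηcl (hDη ▸ hq)
      refine ⟨f, g, isRsopPart_pair_of_sup_eq hq2 ?_, hfspan, hgspan⟩
      rw [← hfspan, ← hgspan]
      exact htr D hD D' hD' hne q ⟨hq, hq'⟩
    · obtain rfl := hPmem p' hp' hq'
      exact absurd hq (hPoff q hp' D hD)
    · obtain rfl := hPmem p hp hq
      exact absurd hq' (hPoff q hp D' hD')
    · obtain rfl := hPmem p hp hq
      obtain rfl := hPmem p' hp' hq'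
      exact absurd rfl hne
  · -- (n)
    rintro q D₁ (hD₁ | ⟨p₁, hp₁, rfl⟩) D₂ (hD₂ | ⟨p₂, hp₂, rfl⟩) D₃ (hD₃ | ⟨p₃, hp₃, rfl⟩) hq1 hq2 hq3
    · by_contra h
      push Not at h
      exact hnt q ⟨D₁, hD₁, D₂, hD₂, D₃, hD₃, h.1, h.2.1, h.2.2, hq1, hq2, hq3⟩
    all_goals first
      | (obtain rfl := hPmem p₃ hp₃ hq3; exact absurd hq1 (hPoff _ hp₃ D₁ hD₁))
      | (obtain rfl := hPmem p₂ hp₂ hq2; exact absurd hq1 (hPoff _ hp₂ D₁ hD₁))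
      | (obtain rfl := hPmem p₁ hp₁ hq1; exact absurd hq2 (hPoff _ hp₁ D₂ hD₂))
      | (obtain rfl := hPmem p₁ hp₁ hq1; exact absurd hq3 (hPoff _ hp₁ D₃ hD₃))
      | (obtain rfl := hPmem p₁ hp₁ hq1; obtain rfl := hPmem p₂ hp₂ hq2; exact Or.inl rfl)

end F75c

end Summit.ResolutionOfSingularities.ResolutionOfSingularities.Theorems

end
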